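import Summits.CriticalPhenomena.PercolationContinuityZ3.Theorems.Transplant.SkelNegParamsLattice
import HarnessLib

/-!
# N1 params, part 0d (q-free arithmetic): THE INVERSE READING OF THE COARSE MAP — a ρ-box of side `r` is a φ-box of side `≤ 80·(n + ℓ + 3|h| + 1)·(r+1)/K`
# (the conversion the fibre schedule needs: windows / habitats live over `ρ ∘ φ` in ρ-units, Φ2's cylinders and the fat / excess radii are φ-planar — NEG-PARAMS (n10) `rmaxφ`)

builds on p205010 (kernel theorem, internal audit signed; external expert review pending) — nothing in this file uses p205010.
Status sentence (coordinator 2026-08-20T04:30Z): "θ(p_c) = 0 on ℤ^d, all d ≥ 2 — kernel-verified (Lean 4/Mathlib, standard axioms); internal adversarial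
audit SIGNED 2026-08-20 04:29Z; external expert review pending."
Lane `prim-bschramm-*`, seat `prim-bschramm-stmt` (gen 12); helper file (`--supports stmt-CriticalPhenomena-4575 --as helper`); ledger HOME/prim-bschramm-stmt/NEG-PARAMS.md v0.6 (n10).
INPUTS: hp-8 g31's `TwoAxis.Para.coarse c s D t = ⌊(c·t + s)/D⌋`, `mul_lam_eq` (`M·λ = D·x`), `lam0/lam1` (TwoAxisParaCells p266166), `Skelφ.coarseSkel/relφ` (p266580); stmt's `NegPrm.vβOf/Dof/coarse`
(SkelNegParamsLattice p272834), `NegPrm.abs_vβ_le` (SkelNegParamsCoarse p267342).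
* §1 `TwoAxis.Para.mul_abs_sub_lt_of_coarse` — the inverse rounding: `|ρ t − ρ t'| ≤ r ⇒ c·|t − t'| < (r+1)·D`;
* §2 for `Skelφ.NegPrm.coarse φ t K n h ℓ v_α` (`A′ = 800`, `c = 20K`): **`coarse_inv₀`** (`20K·|Δφ₀| ≤ 800·(n + |v_α|)·(r+1)`), **`coarse_inv₁`** (`20K·|Δφ₁| ≤ 800·(|h| + |v_β|)·(r+1)`),
  and the packaged sup-bound **`φ_extent_of_coarse_extent`**: `|Δρ|_∞ ≤ r ⇒ K·|Δφ_i| ≤ 80·(n + ℓ + 3|h| + 1)·(r+1)` (`|v_α| ≤ n`, `|v_β| ≤ ℓ + 2|h| + 1`) — so a ρ-window of radius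
  `r` about `w` lies in the φ-square `cyl w (80(n+ℓ+3|h|+1)(r+1)/K + 1)`-type region where Φ2 / `D.R` / the excess radius apply.
[cite: MartineauTassion2017, §4.1–4.3 (the cell lattice z₁u + z₂v and its boxes)] [cite: KozmaNitzan2024, §4 Lemma 12 (p. 24: the planar size of a window)]
-/

namespace Summit.CriticalPhenomena.PercolationContinuityZ3.Theorems.Transplant

/-! ## §1 The inverse rounding -/

namespace TwoAxis.Para

/-- **Inverse reading of the coarse coordinate**: if `⌊(c t + s)/D⌋` and `⌊(c t' + s)/D⌋` differ by at most `r` then `c·|t − t'| < (r + 1)·D` (`0 ≤ c`, `0 < D`).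
[folklore] -/
theorem mul_abs_sub_lt_of_coarse {c s D t t' r : ℤ} (hc : 0 ≤ c) (hD : 0 < D) (h : |coarse c s D t - coarse c s D t'| ≤ r) :
    c * |t - t'| < (r + 1) * D := by
  unfold coarse at h
  set q := (c * t + s) / D with hq
  set q' := (c * t' + s) / D with hq'
  have h1 : q * D ≤ c * t + s := Int.ediv_mul_le _ hD.ne'
  have h2 : c * t + s < (q + 1) * D := Int.lt_ediv_add_one_mul_self _ hD
  have h1' : q' * D ≤ c * t' + s := Int.ediv_mul_le _ hD.ne'
  have h2' : c * t' + s < (q' + 1) * D := Int.lt_ediv_add_one_mul_self _ hD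
  obtain ⟨hl, hu⟩ := abs_le.1 h
  have a : q * D - q' * D ≤ r * D := by
    have := mul_le_mul_of_nonneg_right hu hD.le
    linarith [this, (by ring : (q - q') * D = q * D - q' * D)]
  have b : -r * D ≤ q * D - q' * D := by
    have := mul_le_mul_of_nonneg_right hl hD.le
    linarith [this, (by ring : (q - q') * D = q * D - q' * D)]
  have e : c * |t - t'| = |c * t - c * t'| := by rw [← mul_sub, abs_mul, abs_of_nonneg hc]
  rw [e, abs_lt]
  constructor <;> linarith

end TwoAxis.Para

/-! ## §2 The inverse reading of `NegPrm.coarse` -/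

namespace Skelφ

namespace NegPrm

open Literature.Probability.LatticeModels TwoAxis.Para

variable {V : Type} {φ : V → Site 2}

/-- The two coarse coordinates of `NegPrm.coarse`, unfolded at a vertex. [folklore] -/
theorem coarse_apply (t : V) (K n : ℕ) (h : ℤ) (ℓ : ℕ) (vα : ℤ) (w : V) :
    coarse φ t K n h ℓ vα w 0 = TwoAxis.Para.coarse (20 * K) (Dof n h ℓ vα / 2) (Dof n h ℓ vα) (lam0 800 vα (vβOf n h ℓ vα) (relφ φ t w)) ∧
      coarse φ t K n h ℓ vα w 1 = TwoAxis.Para.coarse (20 * K) (Dof n h ℓ vα / 2) (Dof n h ℓ vα) (lam1 800 n h (relφ φ t w)) := by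
  rw [coarse_eq]; exact ⟨rfl, rfl⟩

/-- **Inverse reading, first planar coordinate**: `|Δρ|_∞ ≤ r ⇒ 20K·|Δφ₀| ≤ 800·(n + |v_α|)·(r + 1)` (`1 ≤ n`, `1 ≤ ℓ`). [this work] -/
theorem coarse_inv₀ (t : V) {K n ℓ : ℕ} (hn : 1 ≤ n) (hℓ : 1 ≤ ℓ) (h : ℤ) (vα : ℤ) {w w' : V} {r : ℤ}
    (h0 : |coarse φ t K n h ℓ vα w 0 - coarse φ t K n h ℓ vα w' 0| ≤ r) (h1 : |coarse φ t K n h ℓ vα w 1 - coarse φ t K n h ℓ vα w' 1| ≤ r) :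
    20 * (K : ℤ) * |φ w 0 - φ w' 0| ≤ 800 * ((n : ℤ) + |vα|) * (r + 1) := by
  have hD : 0 < Dof n h ℓ vα := Dof_pos hn hℓ h vα
  set x := relφ φ t w with hx
  set x' := relφ φ t w' with hx'
  rw [(coarse_apply t K n h ℓ vα w).1, (coarse_apply t K n h ℓ vα w').1] at h0
  rw [(coarse_apply t K n h ℓ vα w).2, (coarse_apply t K n h ℓ vα w').2] at h1
  have hc : (0 : ℤ) ≤ 20 * K := by positivity
  have e0 := mul_abs_sub_lt_of_coarse hc hD h0
  have e1 := mul_abs_sub_lt_of_coarse hc hD h1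
  -- `D Δx₀ = 800 (n Δλ₀ + vα Δλ₁)`
  have hm := (mul_lam_eq 800 n h vα (vβOf n h ℓ vα) x).1
  have hm' := (mul_lam_eq 800 n h vα (vβOf n h ℓ vα) x').1
  have hdx : Dof n h ℓ vα * (x 0 - x' 0) =
      800 * ((n : ℤ) * (lam0 800 vα (vβOf n h ℓ vα) x - lam0 800 vα (vβOf n h ℓ vα) x') +
        vα * (lam1 800 n h x - lam1 800 n h x')) := by
    have : Dof n h ℓ vα = detD 800 n h vα (vβOf n h ℓ vα) := rfl
    rw [this]; linear_combination hm' - hm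
  have hx0 : x 0 - x' 0 = φ w 0 - φ w' 0 := by simp [hx, hx']
  rw [hx0] at hdx
  -- bound `c·D·|Δφ₀| ≤ 800 (n·c|Δλ₀| + |vα|·c|Δλ₁|) < 800 (n + |vα|) (r+1) D`
  have hn0 : (0 : ℤ) ≤ n := by positivity
  have key : Dof n h ℓ vα * (20 * (K : ℤ) * |φ w 0 - φ w' 0|) ≤ Dof n h ℓ vα * (800 * ((n : ℤ) + |vα|) * (r + 1)) := by
    have a1 : |Dof n h ℓ vα * (φ w 0 - φ w' 0)| ≤
        800 * ((n : ℤ) * |lam0 800 vα (vβOf n h ℓ vα) x - lam0 800 vα (vβOf n h ℓ vα) x'| + |vα| * |lam1 800 n h x - lam1 800 n h x'|) := by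
      rw [hdx, abs_mul, abs_of_nonneg (by norm_num : (0 : ℤ) ≤ 800)]
      refine mul_le_mul_of_nonneg_left ?_ (by norm_num)
      calc |(n : ℤ) * (lam0 800 vα (vβOf n h ℓ vα) x - lam0 800 vα (vβOf n h ℓ vα) x') + vα * (lam1 800 n h x - lam1 800 n h x')|
          ≤ |(n : ℤ) * (lam0 800 vα (vβOf n h ℓ vα) x - lam0 800 vα (vβOf n h ℓ vα) x')| + |vα * (lam1 800 n h x - lam1 800 n h x')| := abs_add_le _ _
        _ = (n : ℤ) * |lam0 800 vα (vβOf n h ℓ vα) x - lam0 800 vα (vβOf n h ℓ vα) x'| + |vα| * |lam1 800 n h x - lam1 800 n h x'| := by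
          rw [abs_mul, abs_mul, abs_of_nonneg hn0]
    rw [abs_mul, abs_of_pos hD] at a1
    have a2 : 20 * (K : ℤ) * ((n : ℤ) * |lam0 800 vα (vβOf n h ℓ vα) x - lam0 800 vα (vβOf n h ℓ vα) x'| +
        |vα| * |lam1 800 n h x - lam1 800 n h x'|) ≤ ((n : ℤ) + |vα|) * ((r + 1) * Dof n h ℓ vα) := by
      have b0 := mul_le_mul_of_nonneg_left e0.le hn0
      have b1 := mul_le_mul_of_nonneg_left e1.le (abs_nonneg vα)
      nlinarith [b0, b1]
    nlinarith [a1, a2, hc, mul_le_mul_of_nonneg_left a1 hc]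
  exact le_of_mul_le_mul_left key hD

/-- **Inverse reading, second planar coordinate**: `|Δρ|_∞ ≤ r ⇒ 20K·|Δφ₁| ≤ 800·(|h| + |v_β|)·(r + 1)`. [this work] -/
theorem coarse_inv₁ (t : V) {K n ℓ : ℕ} (hn : 1 ≤ n) (hℓ : 1 ≤ ℓ) (h : ℤ) (vα : ℤ) {w w' : V} {r : ℤ}
    (h0 : |coarse φ t K n h ℓ vα w 0 - coarse φ t K n h ℓ vα w' 0| ≤ r) (h1 : |coarse φ t K n h ℓ vα w 1 - coarse φ t K n h ℓ vα w' 1| ≤ r) :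
    20 * (K : ℤ) * |φ w 1 - φ w' 1| ≤ 800 * (|h| + |vβOf n h ℓ vα|) * (r + 1) := by
  have hD : 0 < Dof n h ℓ vα := Dof_pos hn hℓ h vα
  set x := relφ φ t w with hx
  set x' := relφ φ t w' with hx'
  rw [(coarse_apply t K n h ℓ vα w).1, (coarse_apply t K n h ℓ vα w').1] at h0
  rw [(coarse_apply t K n h ℓ vα w).2, (coarse_apply t K n h ℓ vα w').2] at h1
  have hc : (0 : ℤ) ≤ 20 * K := by positivity
  have e0 := mul_abs_sub_lt_of_coarse hc hD h0
  have e1 := mul_abs_sub_lt_of_coarse hc hD h1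
  have hm := (mul_lam_eq 800 n h vα (vβOf n h ℓ vα) x).2
  have hm' := (mul_lam_eq 800 n h vα (vβOf n h ℓ vα) x').2
  have hdx : Dof n h ℓ vα * (x 1 - x' 1) =
      800 * (h * (lam0 800 vα (vβOf n h ℓ vα) x - lam0 800 vα (vβOf n h ℓ vα) x') +
        vβOf n h ℓ vα * (lam1 800 n h x - lam1 800 n h x')) := by
    have : Dof n h ℓ vα = detD 800 n h vα (vβOf n h ℓ vα) := rfl
    rw [this]; linear_combination hm' - hm
  have hx1 : x 1 - x' 1 = φ w 1 - φ w' 1 := by simp [hx, hx']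
  rw [hx1] at hdx
  have key : Dof n h ℓ vα * (20 * (K : ℤ) * |φ w 1 - φ w' 1|) ≤ Dof n h ℓ vα * (800 * (|h| + |vβOf n h ℓ vα|) * (r + 1)) := by
    have a1 : |Dof n h ℓ vα * (φ w 1 - φ w' 1)| ≤
        800 * (|h| * |lam0 800 vα (vβOf n h ℓ vα) x - lam0 800 vα (vβOf n h ℓ vα) x'| +
          |vβOf n h ℓ vα| * |lam1 800 n h x - lam1 800 n h x'|) := by
      rw [hdx, abs_mul, abs_of_nonneg (by norm_num : (0 : ℤ) ≤ 800)]
      refine mul_le_mul_of_nonneg_left ?_ (by norm_num)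
      calc |h * (lam0 800 vα (vβOf n h ℓ vα) x - lam0 800 vα (vβOf n h ℓ vα) x') + vβOf n h ℓ vα * (lam1 800 n h x - lam1 800 n h x')|
          ≤ |h * (lam0 800 vα (vβOf n h ℓ vα) x - lam0 800 vα (vβOf n h ℓ vα) x')| + |vβOf n h ℓ vα * (lam1 800 n h x - lam1 800 n h x')| :=
            abs_add_le _ _
        _ = |h| * |lam0 800 vα (vβOf n h ℓ vα) x - lam0 800 vα (vβOf n h ℓ vα) x'| + |vβOf n h ℓ vα| * |lam1 800 n h x - lam1 800 n h x'| := by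
          rw [abs_mul, abs_mul]
    rw [abs_mul, abs_of_pos hD] at a1
    have a2 : 20 * (K : ℤ) * (|h| * |lam0 800 vα (vβOf n h ℓ vα) x - lam0 800 vα (vβOf n h ℓ vα) x'| +
        |vβOf n h ℓ vα| * |lam1 800 n h x - lam1 800 n h x'|) ≤ (|h| + |vβOf n h ℓ vα|) * ((r + 1) * Dof n h ℓ vα) := by
      have b0 := mul_le_mul_of_nonneg_left e0.le (abs_nonneg h)
      have b1 := mul_le_mul_of_nonneg_left e1.le (abs_nonneg (vβOf n h ℓ vα))
      nlinarith [b0, b1]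
    nlinarith [a1, a2, hc, mul_le_mul_of_nonneg_left a1 hc]
  exact le_of_mul_le_mul_left key hD

/-- **A ρ-BOX IS A φ-BOX**: if two vertices have coarse positions at distance `≤ r` in each coordinate then `K·|Δφ_i| ≤ 80·(n + ℓ + 3|h| + 1)·(r + 1)` for both planar
coordinates (`|v_α| ≤ n`; `|v_β| ≤ ℓ + 2|h| + 1` by the top-layer constraint) — the planar size of one coarse unit is `≤ 80(n + ℓ + 3|h| + 1)/K` φ-rows, of a cell unit `r = K` it is
`≤ 80(n + ℓ + 3|h| + 1)·(1 + 1/K)`. [this work] -/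
theorem φ_extent_of_coarse_extent (t : V) {K n ℓ : ℕ} (hn : 1 ≤ n) (hℓ : 1 ≤ ℓ) (h : ℤ) {vα : ℤ} (hv : |vα| ≤ (n : ℤ)) {w w' : V} {r : ℤ} (hr : 0 ≤ r)
    (hρ : ∀ i, |coarse φ t K n h ℓ vα w i - coarse φ t K n h ℓ vα w' i| ≤ r) (i : Fin 2) :
    (K : ℤ) * |φ w i - φ w' i| ≤ 80 * ((n : ℤ) + ℓ + 3 * |h| + 1) * (r + 1) := by
  have hvβ : |vβOf n h ℓ vα| ≤ (ℓ : ℤ) + 2 * |h| + 1 :=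
    abs_vβ_le (by exact_mod_cast hn) (by positivity) hv (modulus_vβOf_layer hn h ℓ vα)
  have h0 := hρ 0
  have h1 := hρ 1
  fin_cases i
  · have := coarse_inv₀ t hn hℓ h vα h0 h1
    have hφ := abs_nonneg (φ w 0 - φ w' 0)
    show (K : ℤ) * |φ w 0 - φ w' 0| ≤ 80 * ((n : ℤ) + ℓ + 3 * |h| + 1) * (r + 1)
    nlinarith [hv, abs_nonneg vα, abs_nonneg h, hφ, mul_nonneg hφ hr]
  · have := coarse_inv₁ t hn hℓ h vα h0 h1
    have hφ := abs_nonneg (φ w 1 - φ w' 1)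
    show (K : ℤ) * |φ w 1 - φ w' 1| ≤ 80 * ((n : ℤ) + ℓ + 3 * |h| + 1) * (r + 1)
    nlinarith [hvβ, abs_nonneg (vβOf n h ℓ vα), abs_nonneg h, hφ, mul_nonneg hφ hr]

end NegPrm

end Skelφ

end Summit.CriticalPhenomena.PercolationContinuityZ3.Theorems.Transplant
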